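import Literature.NumberTheory.PAdicHodge.DeRhamBaseChange
import Literature.NumberTheory.Automorphic.AdeleBaseChange
import Literature.NumberTheory.GaloisRepresentations.SorensenPatchingHypotheses
import Literature.NumberTheory.GaloisRepresentations.LabelledWeightsInvariance
import HarnessLib

/-!
# Localisation of a restricted Galois representation: `(ρ|_{Γ_E})|_{Γ_{E_w}}` versus `(ρ|_{Γ_{F_v}})|_{Γ_{E_w}}`

Topic `NumberTheory/GaloisRepresentations`.  Theorem-only file (no definition, no named fact,
D-0026): the number-field plumbing between the two ways of reaching the decomposition group at a
place `w ∣ v` of a finite extension `E/F` of number fields,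

  `Γ_{E_w} → Γ_E → Γ_F`   (localise the restriction `ρ|_{Γ_E}`: `(ρ.restrictField E).toLocal w`) and
  `Γ_{E_w} → Γ_{F_v} → Γ_F` (restrict the localisation `ρ|_{Γ_{F_v}}` along `F_v → E_w`:
                             `(ρ.toLocal v).comp (absGaloisRestrict F_v E_w)`),

each arrow being the tree's restriction map `absGaloisRestrict` (a CHOSEN embedding of algebraic
closures, well defined up to conjugacy: `absGaloisRestrict_isConj_of_algHom_holds`), and `F_v → E_w`
the continuous local base-change map `adicCompletionOfLiesOver F E v w` (`AdeleBaseChange`).  The two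
framed representations of `Γ_{E_w}` differ by a change of frame `ρ(τ)`, `τ ∈ Γ_F`
(`exists_toLocal_restrictField_eq_conj`), under which de Rham-ness, crystallinity and the labelled
Hodge–Tate weights relative to ANY `p`-adic Hodge datum of `E_w` are invariant (§2).  Consequently a
LOCAL base-change statement for the pinned Fontaine data `fontainePst K ℓ hK ↝ fontainePst L ℓ hL`
along a continuous embedding `K → L` of `ℓ`-adic local fields yields the GLOBAL statement for the
pinned data `fontainePstAdicCompletion v ℓ hv ↝ fontainePstAdicCompletion w ℓ hw` of the places
`w ∣ v ∣ ℓ` (§4):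

* `isDeRhamFramed_toLocal_restrictField` — from the named fact
  `Literature.NumberTheory.PAdicHodge.DeRhamBaseChange` (Brinon–Conrad Prop. 6.3.8, vendored, consumed
  here as a hypothesis `(h : DeRhamBaseChange)`): de Rham at every `v ∣ ℓ` for `ρ` ⇒ de Rham at every
  `w ∣ ℓ` for `ρ|_{Γ_E}` — literally the statement of the stub `stub_deRham_restrictField_pinned_of_local`
  of the crux `ReciprocityTRCM` (summit `Langlands`, line `pieces`);
* `isCrystallineFramed_toLocal_restrictField` (`_of_liesOver`),
  `labelledHodgeTateWeightsAt_restrictField_eq_of_liesOver`,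
  `isCrystallineFramed_and_labelledHodgeTateWeightsAt_restrictField` — the same for crystallinity and
  for "all labelled Hodge–Tate weights equal `S`", each from the corresponding LOCAL statement taken as
  an explicit hypothesis (these local statements — Fontaine: `B_cris`-admissibility and `D_dR` commute
  with finite base change — are not yet in the tree; nothing is asserted about them here).  The last is
  hypothesis (2) of ACC+ Thm. 6.1.1 (`ACCGHLNSTT2023.automorphyLifting_crystalline_weightZero`) passing
  from `ρ` over `F` to `ρ|_{Γ_E}` over a finite extension `E`, the step "hypotheses (1)–(13) of §6.5.1
  are satisfied for `E`" of its printed proof (arXiv:1812.09999, p. 89).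

Contents: §1 change of frame commutes with composition (`FramedRep.conj_comp`,
`FramedRep.comp_eq_conj_of_forall_eq`); §2 frame invariance of `IsDeRhamFramed` / `IsCrystallineFramed`
(`HasQlModel` composes with `conj`; the datum's structure field `conj` for the Weil–Deligne half);
§3 `F_v → E_w` makes `F → F_v → E_w` a scalar tower, and the MAIN LEMMA
`exists_toLocal_restrictField_eq_conj` (transitivity of restriction up to conjugacy,
`SorensenPatching.exists_absGaloisRestrict_absGaloisRestrict_eq_conj`, for the two towers
`F ⊆ E ⊆ E_w` and `F ⊆ F_v ⊆ E_w`); §4 the consequences above.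

## References

* [SerreAbelianLadic1968] J.-P. Serre, *Abelian ℓ-adic representations and elliptic curves* (1968),
  Ch. I §2.1 (restriction to decomposition groups, well defined up to conjugation).
* [MilneFT2022] J. S. Milne, *Fields and Galois Theory* (v4.60), Ch. 7 (the absolute Galois group).
* [BrinonConrad2009] O. Brinon, B. Conrad, *CMI Summer School notes on p-adic Hodge theory* (2009),
  Prop. 6.3.8 (de Rham-ness is insensitive to finite extension of the base).
* [FontaineAsterisque223III] J.-M. Fontaine, *Représentations p-adiques semi-stables*, Astérisque 223
  (1994), Exp. III §1.5, §3, §5.1.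
* [ACCGHLNSTT2023] P. B. Allen et al., *Potential automorphy over CM fields*, Ann. of Math. (2) 197
  (2023), Thm. 6.1.1 and §6.5.12 (arXiv:1812.09999, p. 89: "hypotheses (1)–(13) are satisfied for `E`").
-/

noncomputable section

open NumberField IsDedekindDomain Field ValuativeRel
open Literature.NumberTheory.Automorphic Literature.NumberTheory.PAdicHodge

open scoped MatrixGroups

namespace Literature.NumberTheory.GaloisRepresentations

/-! ### §1 Change of frame and composition -/

section Frame

variable {G H : Type*} [Group G] [TopologicalSpace G] [Group H] [TopologicalSpace H]
  {A : Type*} [CommRing A] [TopologicalSpace A] [IsTopologicalRing A] {n : ℕ}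

/-- `(P ρ P⁻¹) ∘ f = P (ρ ∘ f) P⁻¹`. [folklore] -/
theorem FramedRep.conj_comp (P : GL (Fin n) A) (ρ : FramedRep G A n) (f : H →ₜ* G) :
    (FramedRep.conj P ρ).comp f = FramedRep.conj P (ρ.comp f) :=
  ContinuousMonoidHom.ext fun _ => rfl

/-- `conj (P Q) ρ = conj P (conj Q ρ)`. [folklore] -/
theorem FramedRep.conj_mul_eq_conj_conj (P Q : GL (Fin n) A) (ρ : FramedRep G A n) :
    FramedRep.conj (P * Q) ρ = FramedRep.conj P (FramedRep.conj Q ρ) :=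
  ContinuousMonoidHom.ext fun g => by
    simp only [FramedRep.conj_apply, _root_.mul_inv_rev, mul_assoc]

/-- `conj 1 ρ = ρ`. [folklore] -/
theorem FramedRep.conj_one_eq (ρ : FramedRep G A n) : FramedRep.conj 1 ρ = ρ :=
  ContinuousMonoidHom.ext fun g => by simp only [FramedRep.conj_apply, one_mul, inv_one, mul_one]

/-- `conj P⁻¹ (conj P ρ) = ρ`. [folklore] -/
theorem FramedRep.conj_inv_conj_eq (P : GL (Fin n) A) (ρ : FramedRep G A n) :
    FramedRep.conj P⁻¹ (FramedRep.conj P ρ) = ρ := by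
  rw [← FramedRep.conj_mul_eq_conj_conj, inv_mul_cancel, FramedRep.conj_one_eq]

/-- **Composition along conjugate homomorphisms is a change of frame**: if `f₁ σ = τ f₂(σ) τ⁻¹`
for all `σ` (one `τ ∈ G`), then `ρ ∘ f₁ = ρ(τ) (ρ ∘ f₂) ρ(τ)⁻¹`. [folklore] -/
theorem FramedRep.comp_eq_conj_of_forall_eq (ρ : FramedRep G A n) {f₁ f₂ : H →ₜ* G} {τ : G}
    (h : ∀ σ, f₁ σ = τ * f₂ σ * τ⁻¹) : ρ.comp f₁ = FramedRep.conj (ρ τ) (ρ.comp f₂) :=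
  ContinuousMonoidHom.ext fun σ => by
    show ρ (f₁ σ) = ρ τ * ρ (f₂ σ) * (ρ τ)⁻¹
    rw [h σ, map_mul, map_mul, map_inv]

end Frame

/-! ### §2 Frame invariance of de Rham-ness and crystallinity (any datum) -/

section FrameInvariance

variable {K : Type} [Field K] [ValuativeRel K] [TopologicalSpace K] [IsNonarchimedeanLocalField K]
  {ℓ : ℕ} [Fact ℓ.Prime] {n : ℕ}

/-- De Rham-ness passes to a conjugate frame (a `ℚ_ℓ`-model of `ρ` is one of `P ρ P⁻¹`:
`HasQlModel` composes with `conj`). [cite: FontaineAsterisque223III, Exp. III §1.5 and §3] -/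
theorem PstWeilDeligneData.IsDeRhamFramed.conj_frame {𝔇 : PstWeilDeligneData K ℓ}
    {ρ : FramedRep (absoluteGaloisGroup K) (PadicAlgCl ℓ) n} (h : 𝔇.IsDeRhamFramed ρ)
    (P : GL (Fin n) (PadicAlgCl ℓ)) : 𝔇.IsDeRhamFramed (FramedRep.conj P ρ) := by
  obtain ⟨E, hE, rE, ⟨P₀, hP₀⟩, hdR⟩ := h
  exact ⟨E, hE, rE, ⟨P * P₀, by rw [FramedRep.conj_mul_eq_conj_conj, hP₀]⟩, hdR⟩

/-- **De Rham-ness does not see the frame**: `𝔇.IsDeRhamFramed (P ρ P⁻¹) ↔ 𝔇.IsDeRhamFramed ρ`,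
for every `p`-adic Hodge datum `𝔇` of `K`. [cite: FontaineAsterisque223III, Exp. III §1.5 and §3] -/
theorem PstWeilDeligneData.isDeRhamFramed_conj_iff (𝔇 : PstWeilDeligneData K ℓ)
    (P : GL (Fin n) (PadicAlgCl ℓ)) (ρ : FramedRep (absoluteGaloisGroup K) (PadicAlgCl ℓ) n) :
    𝔇.IsDeRhamFramed (FramedRep.conj P ρ) ↔ 𝔇.IsDeRhamFramed ρ :=
  ⟨fun h => by simpa only [FramedRep.conj_inv_conj_eq] using h.conj_frame P⁻¹,
    fun h => h.conj_frame P⟩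

/-- Crystallinity passes to a conjugate frame: the de Rham half by `IsDeRhamFramed.conj_frame`, the
Weil–Deligne half (`N = 0`, inertia trivial) by the datum's structure field `conj` (the attached
Weil–Deligne representation does not see the frame). [cite: FontaineAsterisque223III, Exp. III §5.1] -/
theorem PstWeilDeligneData.IsCrystallineFramed.conj_frame {𝔇 : PstWeilDeligneData K ℓ}
    {ρ : FramedRep (absoluteGaloisGroup K) (PadicAlgCl ℓ) n} (h : 𝔇.IsCrystallineFramed ρ)
    (P : GL (Fin n) (PadicAlgCl ℓ)) : 𝔇.IsCrystallineFramed (FramedRep.conj P ρ) := by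
  obtain ⟨hdR, r, hr, hN, hunr⟩ := h
  exact ⟨hdR.conj_frame P, r, 𝔇.conj P ρ r hr, hN, hunr⟩

/-- **Crystallinity does not see the frame**: `𝔇.IsCrystallineFramed (P ρ P⁻¹) ↔ 𝔇.IsCrystallineFramed ρ`.
[cite: FontaineAsterisque223III, Exp. III §5.1] -/
theorem PstWeilDeligneData.isCrystallineFramed_conj_iff (𝔇 : PstWeilDeligneData K ℓ)
    (P : GL (Fin n) (PadicAlgCl ℓ)) (ρ : FramedRep (absoluteGaloisGroup K) (PadicAlgCl ℓ) n) :
    𝔇.IsCrystallineFramed (FramedRep.conj P ρ) ↔ 𝔇.IsCrystallineFramed ρ :=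
  ⟨fun h => by simpa only [FramedRep.conj_inv_conj_eq] using h.conj_frame P⁻¹,
    fun h => h.conj_frame P⟩

/-- **The labelled Hodge–Tate weights do not see the frame** (restatement of the tree's
`PeriodRingData.labelledHodgeTateWeights_conj` for `FramedRep.conj P ρ` and any datum `𝔇`).
[cite: FontaineAsterisque223III, Exp. III §1.5] -/
theorem PstWeilDeligneData.labelledHodgeTateWeights_conj_eq (𝔇 : PstWeilDeligneData K ℓ)
    (P : GL (Fin n) (PadicAlgCl ℓ)) (ρ : FramedRep (absoluteGaloisGroup K) (PadicAlgCl ℓ) n)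
    (τ : K →+* PadicAlgCl ℓ) :
    (letI := 𝔇.algebra
     𝔇.𝔅.labelledHodgeTateWeights (FramedRep.toContinuousRep (FramedRep.conj P ρ)) τ) =
      (letI := 𝔇.algebra; 𝔇.𝔅.labelledHodgeTateWeights (FramedRep.toContinuousRep ρ) τ) := by
  letI := 𝔇.algebra
  exact 𝔇.𝔅.labelledHodgeTateWeights_conj ρ P τ

end FrameInvariance

/-! ### §3 The place `w ∣ v`: `F → F_v → E_w` and the two routes `Γ_{E_w} → Γ_F` -/

section Tower

variable {F E : Type} [Field F] [NumberField F] [Field E] [NumberField E] [Algebra F E]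

omit [NumberField F] [NumberField E] in
/-- For `w ∣ v` (`w.asIdeal` lies over `v.asIdeal`), a rational integer lies in `w` iff it lies in
`v`. [folklore] -/
theorem natCast_mem_asIdeal_iff_of_liesOver (v : HeightOneSpectrum (𝓞 F))
    (w : HeightOneSpectrum (𝓞 E)) [h : w.asIdeal.LiesOver v.asIdeal] (q : ℕ) :
    ((q : ℕ) : 𝓞 E) ∈ w.asIdeal ↔ ((q : ℕ) : 𝓞 F) ∈ v.asIdeal := by
  rw [h.over, Ideal.under, Ideal.mem_comap, map_natCast]

omit [NumberField F] [NumberField E] in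
/-- The place `w ∩ 𝓞 F` below `w` lies under `w` (tautological `LiesOver` witness of
`HeightOneSpectrum.under`). [folklore] -/
theorem liesOver_under (w : HeightOneSpectrum (𝓞 E)) :
    w.asIdeal.LiesOver (w.under (𝓞 F)).asIdeal :=
  ⟨rfl⟩

/-- **`F → F_v → E_w` is a scalar tower** for the local base-change map
`adicCompletionOfLiesOver F E v w : F_v →+* E_w` (which extends `F → E`,
`adicCompletionOfLiesOver_coe`). [folklore] -/
theorem isScalarTower_adicCompletionOfLiesOver (v : HeightOneSpectrum (𝓞 F))
    (w : HeightOneSpectrum (𝓞 E)) [w.asIdeal.LiesOver v.asIdeal] :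
    letI := (adicCompletionOfLiesOver F E v w).toAlgebra
    IsScalarTower F (v.adicCompletion F) (w.adicCompletion E) := by
  letI := (adicCompletionOfLiesOver F E v w).toAlgebra
  refine IsScalarTower.of_algebraMap_eq fun x => ?_
  rw [RingHom.algebraMap_toAlgebra]
  change ((algebraMap F E x : E) : w.adicCompletion E) =
    adicCompletionOfLiesOver F E v w ((algebraMap F F x : F) : v.adicCompletion F)
  rw [adicCompletionOfLiesOver_coe]
  rfl

/-- **The two routes `Γ_{E_w} → Γ_F` are conjugate.**  For `w ∣ v` the composites
`Γ_{E_w} → Γ_E → Γ_F` and `Γ_{E_w} → Γ_{F_v} → Γ_F` of the tree's restriction maps differ by an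
inner automorphism of `Γ_F` (both are compatible with an `F`-embedding `F̄ → \overline{E_w}`;
`SorensenPatching.exists_absGaloisRestrict_absGaloisRestrict_eq_conj` for the towers `F ⊆ E ⊆ E_w`
and `F ⊆ F_v ⊆ E_w`). [cite: SerreAbelianLadic1968, Ch. I §2.1] [cite: MilneFT2022, Ch. 7] -/
theorem exists_absGaloisRestrict_adicCompletion_eq_conj (v : HeightOneSpectrum (𝓞 F))
    (w : HeightOneSpectrum (𝓞 E)) [w.asIdeal.LiesOver v.asIdeal] :
    letI := (adicCompletionOfLiesOver F E v w).toAlgebra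
    ∃ τ : absoluteGaloisGroup F, ∀ σ : absoluteGaloisGroup (w.adicCompletion E),
      absGaloisRestrict F E (absGaloisRestrict E (w.adicCompletion E) σ) =
        τ * absGaloisRestrict F (v.adicCompletion F)
              (absGaloisRestrict (v.adicCompletion F) (w.adicCompletion E) σ) * τ⁻¹ := by
  letI := (adicCompletionOfLiesOver F E v w).toAlgebra
  haveI := isScalarTower_adicCompletionOfLiesOver v w
  obtain ⟨τ₁, h₁⟩ :=
    SorensenPatching.exists_absGaloisRestrict_absGaloisRestrict_eq_conj F E (w.adicCompletion E)
  obtain ⟨τ₂, h₂⟩ := SorensenPatching.exists_absGaloisRestrict_absGaloisRestrict_eq_conj F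
    (v.adicCompletion F) (w.adicCompletion E)
  refine ⟨τ₁ * τ₂⁻¹, fun σ => ?_⟩
  rw [h₁ σ, h₂ σ]
  group

variable {A : Type*} [CommRing A] [TopologicalSpace A] [IsTopologicalRing A] {n : ℕ}

/-- **MAIN LEMMA — localising the restriction is restricting the localisation, up to a change of
frame.**  For `ρ : Γ_F → GL_n(A)`, a finite extension `E/F` and `w ∣ v`:
`(ρ|_{Γ_E})|_{Γ_{E_w}} = ρ(τ) · (ρ|_{Γ_{F_v}})|_{Γ_{E_w}} · ρ(τ)⁻¹` for some `τ ∈ Γ_F`, where the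
restriction `Γ_{E_w} → Γ_{F_v}` is taken along the local base-change map `F_v → E_w`.
[cite: SerreAbelianLadic1968, Ch. I §2.1] -/
theorem exists_toLocal_restrictField_eq_conj (ρ : FramedGaloisRep F A n)
    (v : HeightOneSpectrum (𝓞 F)) (w : HeightOneSpectrum (𝓞 E)) [w.asIdeal.LiesOver v.asIdeal] :
    letI := (adicCompletionOfLiesOver F E v w).toAlgebra
    ∃ τ : absoluteGaloisGroup F,
      (ρ.restrictField E).toLocal w =
        FramedRep.conj (ρ τ) ((ρ.toLocal v).comp
          (absGaloisRestrict (v.adicCompletion F) (w.adicCompletion E))) := by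
  letI := (adicCompletionOfLiesOver F E v w).toAlgebra
  obtain ⟨τ, hτ⟩ := exists_absGaloisRestrict_adicCompletion_eq_conj v w
  exact ⟨τ, FramedRep.comp_eq_conj_of_forall_eq ρ
    (f₁ := (absGaloisRestrict F E).comp (absGaloisRestrict E (w.adicCompletion E)))
    (f₂ := (absGaloisRestrict F (v.adicCompletion F)).comp
      (absGaloisRestrict (v.adicCompletion F) (w.adicCompletion E))) hτ⟩

end Tower

/-! ### §4 Local base change of the pinned data ⇒ restriction along `E/F` for the data of the places -/

section Pinned

variable {F E : Type} [Field F] [NumberField F] [Field E] [NumberField E] [Algebra F E]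
  {ℓ : ℕ} [Fact ℓ.Prime] {n : ℕ}

/-- **De Rham-ness of the pinned data restricts along `E/F`, place by place** — from the named fact
`DeRhamBaseChange` (Brinon–Conrad Prop. 6.3.8 for THE data `fontainePst`): if `ρ|_{Γ_{F_v}}` is de
Rham for `fontainePstAdicCompletion v ℓ hv` and `w ∣ v`, then `(ρ|_{Γ_E})|_{Γ_{E_w}}` is de Rham for
`fontainePstAdicCompletion w ℓ hw` (apply the local fact along the continuous `F_v → E_w` to
`ρ|_{Γ_{F_v}}`, then change the frame by `ρ(τ)`, `exists_toLocal_restrictField_eq_conj`).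
[cite: BrinonConrad2009, Prop. 6.3.8] [cite: SerreAbelianLadic1968, Ch. I §2.1] -/
theorem isDeRhamFramed_toLocal_restrictField_of_liesOver (h : DeRhamBaseChange)
    (ρ : FramedGaloisRep F (PadicAlgCl ℓ) n) (v : HeightOneSpectrum (𝓞 F))
    (w : HeightOneSpectrum (𝓞 E)) [w.asIdeal.LiesOver v.asIdeal] (hv : ((ℓ : ℕ) : 𝓞 F) ∈ v.asIdeal)
    (hw : ((ℓ : ℕ) : 𝓞 E) ∈ w.asIdeal)
    (hρ : (fontainePstAdicCompletion v ℓ hv).IsDeRhamFramed (ρ.toLocal v)) :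
    (fontainePstAdicCompletion w ℓ hw).IsDeRhamFramed ((ρ.restrictField E).toLocal w) := by
  letI := (adicCompletionOfLiesOver F E v w).toAlgebra
  obtain ⟨τ, hτ⟩ := exists_toLocal_restrictField_eq_conj ρ v w
  rw [hτ, PstWeilDeligneData.isDeRhamFramed_conj_iff]
  haveI := LocalField.charZero_adicCompletion v
  haveI := LocalField.charZero_adicCompletion w
  exact h (v.adicCompletion F) (w.adicCompletion E) (continuous_adicCompletionOfLiesOver F E v w) ℓ
    (LocalField.valuation_adicCompletion_natCast_lt_one v ℓ hv)
    (LocalField.valuation_adicCompletion_natCast_lt_one w ℓ hw) n (ρ.toLocal v) hρ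

/-- **De Rham at every `v ∣ ℓ` for `ρ` ⇒ de Rham at every `w ∣ ℓ` for `ρ|_{Γ_E}`, for THE pinned
data** — from the named fact `DeRhamBaseChange`; with `v := w ∩ 𝓞 F`.  This is the statement of
the stub `stub_deRham_restrictField_pinned_of_local` (crux `ReciprocityTRCM`, line `pieces`) with
its first hypothesis named. [cite: BrinonConrad2009, Prop. 6.3.8] [cite: SerreAbelianLadic1968, Ch. I §2.1] -/
theorem isDeRhamFramed_toLocal_restrictField (h : DeRhamBaseChange)
    (ρ : FramedGaloisRep F (PadicAlgCl ℓ) n)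
    (hρ : ∀ (v : HeightOneSpectrum (𝓞 F)) (hv : ((ℓ : ℕ) : 𝓞 F) ∈ v.asIdeal),
      (fontainePstAdicCompletion v ℓ hv).IsDeRhamFramed (ρ.toLocal v))
    (w : HeightOneSpectrum (𝓞 E)) (hw : ((ℓ : ℕ) : 𝓞 E) ∈ w.asIdeal) :
    (fontainePstAdicCompletion w ℓ hw).IsDeRhamFramed ((ρ.restrictField E).toLocal w) :=
  haveI := liesOver_under (F := F) w
  have hv : ((ℓ : ℕ) : 𝓞 F) ∈ (w.under (𝓞 F)).asIdeal :=
    (natCast_mem_asIdeal_iff_of_liesOver (w.under (𝓞 F)) w ℓ).1 hw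
  isDeRhamFramed_toLocal_restrictField_of_liesOver h ρ (w.under (𝓞 F)) w hv hw (hρ _ hv)

/-- **Crystallinity of the pinned data restricts along `E/F`, place by place — modulo the LOCAL
statement** `hcr` ("crystalline for `fontainePst K ℓ hK` ⇒ crystalline for `fontainePst L ℓ hL` after
restriction along a continuous `K → L`"; Fontaine: `B_cris`-admissibility is insensitive to finite
base change — not yet in the tree, taken here as a hypothesis).
[cite: FontaineAsterisque223III, Exp. III §5.1] [cite: SerreAbelianLadic1968, Ch. I §2.1] -/
theorem isCrystallineFramed_toLocal_restrictField_of_liesOver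
    (hcr : ∀ (K L : Type) [Field K] [ValuativeRel K] [TopologicalSpace K]
      [IsNonarchimedeanLocalField K] [CharZero K] [Field L] [ValuativeRel L] [TopologicalSpace L]
      [IsNonarchimedeanLocalField L] [CharZero L] [Algebra K L], Continuous (algebraMap K L) →
      ∀ (hK : valuation K (ℓ : K) < 1) (hL : valuation L (ℓ : L) < 1) (n : ℕ)
        (ρ : FramedRep (absoluteGaloisGroup K) (PadicAlgCl ℓ) n),
        (fontainePst K ℓ hK).IsCrystallineFramed ρ →
          (fontainePst L ℓ hL).IsCrystallineFramed (ρ.comp (absGaloisRestrict K L)))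
    (ρ : FramedGaloisRep F (PadicAlgCl ℓ) n) (v : HeightOneSpectrum (𝓞 F))
    (w : HeightOneSpectrum (𝓞 E)) [w.asIdeal.LiesOver v.asIdeal] (hv : ((ℓ : ℕ) : 𝓞 F) ∈ v.asIdeal)
    (hw : ((ℓ : ℕ) : 𝓞 E) ∈ w.asIdeal)
    (hρ : (fontainePstAdicCompletion v ℓ hv).IsCrystallineFramed (ρ.toLocal v)) :
    (fontainePstAdicCompletion w ℓ hw).IsCrystallineFramed ((ρ.restrictField E).toLocal w) := by
  letI := (adicCompletionOfLiesOver F E v w).toAlgebra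
  obtain ⟨τ, hτ⟩ := exists_toLocal_restrictField_eq_conj ρ v w
  rw [hτ, PstWeilDeligneData.isCrystallineFramed_conj_iff]
  haveI := LocalField.charZero_adicCompletion v
  haveI := LocalField.charZero_adicCompletion w
  exact hcr (v.adicCompletion F) (w.adicCompletion E) (continuous_adicCompletionOfLiesOver F E v w)
    (LocalField.valuation_adicCompletion_natCast_lt_one v ℓ hv)
    (LocalField.valuation_adicCompletion_natCast_lt_one w ℓ hw) n (ρ.toLocal v) hρ

/-- **Crystalline at every `v ∣ ℓ` for `ρ` ⇒ crystalline at every `w ∣ ℓ` for `ρ|_{Γ_E}`, for THE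
pinned data — modulo the local statement `hcr`.** [cite: FontaineAsterisque223III, Exp. III §5.1]
[cite: SerreAbelianLadic1968, Ch. I §2.1] -/
theorem isCrystallineFramed_toLocal_restrictField
    (hcr : ∀ (K L : Type) [Field K] [ValuativeRel K] [TopologicalSpace K]
      [IsNonarchimedeanLocalField K] [CharZero K] [Field L] [ValuativeRel L] [TopologicalSpace L]
      [IsNonarchimedeanLocalField L] [CharZero L] [Algebra K L], Continuous (algebraMap K L) →
      ∀ (hK : valuation K (ℓ : K) < 1) (hL : valuation L (ℓ : L) < 1) (n : ℕ)
        (ρ : FramedRep (absoluteGaloisGroup K) (PadicAlgCl ℓ) n),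
        (fontainePst K ℓ hK).IsCrystallineFramed ρ →
          (fontainePst L ℓ hL).IsCrystallineFramed (ρ.comp (absGaloisRestrict K L)))
    (ρ : FramedGaloisRep F (PadicAlgCl ℓ) n)
    (hρ : ∀ (v : HeightOneSpectrum (𝓞 F)) (hv : ((ℓ : ℕ) : 𝓞 F) ∈ v.asIdeal),
      (fontainePstAdicCompletion v ℓ hv).IsCrystallineFramed (ρ.toLocal v))
    (w : HeightOneSpectrum (𝓞 E)) (hw : ((ℓ : ℕ) : 𝓞 E) ∈ w.asIdeal) :
    (fontainePstAdicCompletion w ℓ hw).IsCrystallineFramed ((ρ.restrictField E).toLocal w) :=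
  haveI := liesOver_under (F := F) w
  have hv : ((ℓ : ℕ) : 𝓞 F) ∈ (w.under (𝓞 F)).asIdeal :=
    (natCast_mem_asIdeal_iff_of_liesOver (w.under (𝓞 F)) w ℓ).1 hw
  isCrystallineFramed_toLocal_restrictField_of_liesOver hcr ρ (w.under (𝓞 F)) w hv hw (hρ _ hv)

/-- **"All labelled Hodge–Tate weights equal `S`" restricts along `E/F`, place by place — modulo the
LOCAL statement** `hHT` (if `HT_{τ'}(ρ) = S` for every `ℚ_ℓ`-embedding `τ' : K → ℚ̄_ℓ`, then
`HT_{τ''}(ρ|_{Γ_L}) = S` for every `τ'' : L → ℚ̄_ℓ`, for THE data `fontainePst`; Fontaine: `D_dR`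
commutes with finite base change, `HT_{τ''}(ρ|_{Γ_L}) = HT_{τ''|_K}(ρ)` — not yet in the tree, taken
here as a hypothesis).  In the vocabulary of the global wrapper `labelledHodgeTateWeightsAt`.
[cite: FontaineAsterisque223III, Exp. III §1.5 and §3] [cite: SerreAbelianLadic1968, Ch. I §2.1] -/
theorem labelledHodgeTateWeightsAt_restrictField_eq_of_liesOver
    (hHT : ∀ (K L : Type) [Field K] [ValuativeRel K] [TopologicalSpace K]
      [IsNonarchimedeanLocalField K] [CharZero K] [Field L] [ValuativeRel L] [TopologicalSpace L]
      [IsNonarchimedeanLocalField L] [CharZero L] [Algebra K L], Continuous (algebraMap K L) →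
      ∀ (hK : valuation K (ℓ : K) < 1) (hL : valuation L (ℓ : L) < 1) (n : ℕ)
        (ρ : FramedRep (absoluteGaloisGroup K) (PadicAlgCl ℓ) n) (S : Multiset ℤ),
        (letI := (fontainePst K ℓ hK).algebra
         ∀ τ' : K →ₐ[ℚ_[ℓ]] PadicAlgCl ℓ,
           (fontainePst K ℓ hK).𝔅.labelledHodgeTateWeights (FramedRep.toContinuousRep ρ)
             τ'.toRingHom = S) →
        (letI := (fontainePst L ℓ hL).algebra
         ∀ τ'' : L →ₐ[ℚ_[ℓ]] PadicAlgCl ℓ,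
           (fontainePst L ℓ hL).𝔅.labelledHodgeTateWeights
             (FramedRep.toContinuousRep (ρ.comp (absGaloisRestrict K L))) τ''.toRingHom = S))
    (ρ : FramedGaloisRep F (PadicAlgCl ℓ) n) (S : Multiset ℤ) (v : HeightOneSpectrum (𝓞 F))
    (w : HeightOneSpectrum (𝓞 E)) [w.asIdeal.LiesOver v.asIdeal] (hv : ((ℓ : ℕ) : 𝓞 F) ∈ v.asIdeal)
    (hw : ((ℓ : ℕ) : 𝓞 E) ∈ w.asIdeal)
    (hρ : letI := (fontainePstAdicCompletion v ℓ hv).algebra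
      ∀ τ' : v.adicCompletion F →ₐ[ℚ_[ℓ]] PadicAlgCl ℓ,
        ρ.labelledHodgeTateWeightsAt v (fontainePstAdicCompletion v ℓ hv).algebra
          (fontainePstAdicCompletion v ℓ hv).𝔅 τ'.toRingHom = S) :
    letI := (fontainePstAdicCompletion w ℓ hw).algebra
    ∀ τ'' : w.adicCompletion E →ₐ[ℚ_[ℓ]] PadicAlgCl ℓ,
      (ρ.restrictField E).labelledHodgeTateWeightsAt w (fontainePstAdicCompletion w ℓ hw).algebra
        (fontainePstAdicCompletion w ℓ hw).𝔅 τ''.toRingHom = S := by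
  letI := (adicCompletionOfLiesOver F E v w).toAlgebra
  haveI := LocalField.charZero_adicCompletion v
  haveI := LocalField.charZero_adicCompletion w
  letI := (fontainePstAdicCompletion w ℓ hw).algebra
  intro τ''
  obtain ⟨τ, hτ⟩ := exists_toLocal_restrictField_eq_conj ρ v w
  -- the local statement along `F_v → E_w`, applied to `ρ|_{Γ_{F_v}}`
  have key := hHT (v.adicCompletion F) (w.adicCompletion E)
    (continuous_adicCompletionOfLiesOver F E v w)
    (LocalField.valuation_adicCompletion_natCast_lt_one v ℓ hv)
    (LocalField.valuation_adicCompletion_natCast_lt_one w ℓ hw) n (ρ.toLocal v) S hρ τ''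
  -- change of frame
  calc (ρ.restrictField E).labelledHodgeTateWeightsAt w (fontainePstAdicCompletion w ℓ hw).algebra
          (fontainePstAdicCompletion w ℓ hw).𝔅 τ''.toRingHom
      = (letI := (fontainePstAdicCompletion w ℓ hw).algebra
         (fontainePstAdicCompletion w ℓ hw).𝔅.labelledHodgeTateWeights
           (FramedRep.toContinuousRep ((ρ.toLocal v).comp
             (absGaloisRestrict (v.adicCompletion F) (w.adicCompletion E)))) τ''.toRingHom) := by
        rw [FramedGaloisRep.labelledHodgeTateWeightsAt_def, hτ]
        exact PstWeilDeligneData.labelledHodgeTateWeights_conj_eq _ (ρ τ) _ τ''.toRingHom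
    _ = S := key

/-- **Hypothesis (2) of ACC+ Thm. 6.1.1 passes from `ρ` over `F` to `ρ|_{Γ_E}` over a finite
extension `E` — modulo the two LOCAL base-change statements `hcr`, `hHT` for the pinned Fontaine
data**: if for every `v ∣ ℓ` of `F`, `ρ|_{Γ_{F_v}}` is crystalline for `fontainePstAdicCompletion v ℓ hv`
with `HT_{τ'} = S` for all labels `τ'`, then for every `w ∣ ℓ` of `E`, `(ρ|_{Γ_E})|_{Γ_{E_w}}` is
crystalline for `fontainePstAdicCompletion w ℓ hw` with `HT_{τ''} = S` for all labels `τ''` (the step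
"hypotheses (1)–(13) of §6.5.1 are satisfied for `E`" of the printed proof of Thm. 6.1.1, for the
crystalline / Hodge–Tate clause; in the vocabulary of
`ACCGHLNSTT2023.automorphyLifting_crystalline_weightZero`, there with `S = {0, 1, …, n-1}`).
[cite: ACCGHLNSTT2023, §6.5.12 (proof of Thm. 6.1.1, p. 89)] [cite: FontaineAsterisque223III, Exp. III §5.1]
[cite: SerreAbelianLadic1968, Ch. I §2.1] -/
theorem isCrystallineFramed_and_labelledHodgeTateWeightsAt_restrictField
    (hcr : ∀ (K L : Type) [Field K] [ValuativeRel K] [TopologicalSpace K]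
      [IsNonarchimedeanLocalField K] [CharZero K] [Field L] [ValuativeRel L] [TopologicalSpace L]
      [IsNonarchimedeanLocalField L] [CharZero L] [Algebra K L], Continuous (algebraMap K L) →
      ∀ (hK : valuation K (ℓ : K) < 1) (hL : valuation L (ℓ : L) < 1) (n : ℕ)
        (ρ : FramedRep (absoluteGaloisGroup K) (PadicAlgCl ℓ) n),
        (fontainePst K ℓ hK).IsCrystallineFramed ρ →
          (fontainePst L ℓ hL).IsCrystallineFramed (ρ.comp (absGaloisRestrict K L)))
    (hHT : ∀ (K L : Type) [Field K] [ValuativeRel K] [TopologicalSpace K]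
      [IsNonarchimedeanLocalField K] [CharZero K] [Field L] [ValuativeRel L] [TopologicalSpace L]
      [IsNonarchimedeanLocalField L] [CharZero L] [Algebra K L], Continuous (algebraMap K L) →
      ∀ (hK : valuation K (ℓ : K) < 1) (hL : valuation L (ℓ : L) < 1) (n : ℕ)
        (ρ : FramedRep (absoluteGaloisGroup K) (PadicAlgCl ℓ) n) (S : Multiset ℤ),
        (letI := (fontainePst K ℓ hK).algebra
         ∀ τ' : K →ₐ[ℚ_[ℓ]] PadicAlgCl ℓ,
           (fontainePst K ℓ hK).𝔅.labelledHodgeTateWeights (FramedRep.toContinuousRep ρ)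
             τ'.toRingHom = S) →
        (letI := (fontainePst L ℓ hL).algebra
         ∀ τ'' : L →ₐ[ℚ_[ℓ]] PadicAlgCl ℓ,
           (fontainePst L ℓ hL).𝔅.labelledHodgeTateWeights
             (FramedRep.toContinuousRep (ρ.comp (absGaloisRestrict K L))) τ''.toRingHom = S))
    (ρ : FramedGaloisRep F (PadicAlgCl ℓ) n) (S : Multiset ℤ)
    (h2 : ∀ (v : HeightOneSpectrum (𝓞 F)) (hv : ((ℓ : ℕ) : 𝓞 F) ∈ v.asIdeal),
      (fontainePstAdicCompletion v ℓ hv).IsCrystallineFramed (ρ.toLocal v) ∧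
        (letI := (fontainePstAdicCompletion v ℓ hv).algebra
         ∀ τ' : v.adicCompletion F →ₐ[ℚ_[ℓ]] PadicAlgCl ℓ,
           ρ.labelledHodgeTateWeightsAt v (fontainePstAdicCompletion v ℓ hv).algebra
             (fontainePstAdicCompletion v ℓ hv).𝔅 τ'.toRingHom = S))
    (w : HeightOneSpectrum (𝓞 E)) (hw : ((ℓ : ℕ) : 𝓞 E) ∈ w.asIdeal) :
    (fontainePstAdicCompletion w ℓ hw).IsCrystallineFramed ((ρ.restrictField E).toLocal w) ∧
      (letI := (fontainePstAdicCompletion w ℓ hw).algebra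
       ∀ τ'' : w.adicCompletion E →ₐ[ℚ_[ℓ]] PadicAlgCl ℓ,
         (ρ.restrictField E).labelledHodgeTateWeightsAt w (fontainePstAdicCompletion w ℓ hw).algebra
           (fontainePstAdicCompletion w ℓ hw).𝔅 τ''.toRingHom = S) :=
  haveI := liesOver_under (F := F) w
  have hv : ((ℓ : ℕ) : 𝓞 F) ∈ (w.under (𝓞 F)).asIdeal :=
    (natCast_mem_asIdeal_iff_of_liesOver (w.under (𝓞 F)) w ℓ).1 hw
  ⟨isCrystallineFramed_toLocal_restrictField_of_liesOver hcr ρ (w.under (𝓞 F)) w hv hw (h2 _ hv).1,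
    labelledHodgeTateWeightsAt_restrictField_eq_of_liesOver hHT ρ S (w.under (𝓞 F)) w hv hw
      (h2 _ hv).2⟩

end Pinned

end Literature.NumberTheory.GaloisRepresentations

end
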